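import Summits.NavierStokesRegularity.FluidComputer.PalasekTowerRegisterGlobalHalvesAt
import Literature.Analysis.FluidPDE.ClassicalContinuationAPriori
import Literature.Analysis.FluidPDE.ClassicalSolutionGlueIcc

/-!
# REGISTER v2.3′: the upper half AT level `k ≥ 1` re-typed — `ContinuationEnvelopeAt k ↔ LocalContinuationAt k ∧ AprioriCeilingAt k`;
# at the first rung, «no premature blow-up» ⇐ «the level-1 flow crosses the end of the forced era» + «no overshoot»

Cell `ns-blowup`, seat `ns-blowup-ecbridge-7` (literature-prover; D-0074 GROUP C «BRIDGE SUPPORT»;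
bears_on LADDER-NS N1, route `PalasekTowerBreakdown`, child crux item stmt-NavierStokesRegularity-19249
`HeredityAtOne` — supported, NOT closed or claimed). Companion of
`PalasekTowerRegisterGlobalHalvesAt.lean` (this seat, p422702: the level-wise halves
`ContinuationEnvelopeAt k` / `ReadoutFloorsAt k` and `HeredityAtOne ↔ ContinuationEnvelopeAt 1 ∧
ReadoutFloorsAt 1`), of `PalasekTowerRegisterGlobalApriori.lean` (ecbridge-5 g2, p422740: at the
GENERIC levels `k ≥ 2` the upper half is equivalent to an a-priori ceiling — existence of the
continuation is a theorem, because the stage translated to the origin `τ 1` is an UNFORCED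
classical solution on a slab of POSITIVE length `τ k - τ 1`, to which the a-priori continuation
principle applies) and of the Literature theorems `exists_classical_extension_Icc_of_apriori_bound`
(ecbridge-8, `ClassicalContinuationAPriori.lean`: a-priori `L^∞` bound ⇒ continuation, unforced,
closed slabs, pressure matched) and `IsClassicalNSSolutionOn.glue_Icc` (`ClassicalSolutionGlueIcc.lean`).
LABEL: E–C typing (KERNEL: two level-indexed `@[conjecture]` predicates and PROVED equivalences; no
named fact). WHAT THIS IS NOT: not Navier–Stokes evidence — no stage, flow or tower is constructed or
claimed; `ContinuationEnvelopeAt k`, `LocalContinuationAt k`, `AprioriCeilingAt k` are OPEN statements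
appearing only inside equivalences / implications.

## Why the first rung needs one more stub than the generic levels

At `k = 1` the growth window `[τ 1, τ 2]` starts EXACTLY where the forced era ends: the stage
translated to `τ 1` is an unforced classical solution on a slab of length `0`, so the a-priori
principle (which restarts a Leray–Hopf scaffold from a slab of positive length) has nothing to
start from, and no FORCED local well-posedness on `ℝ³` is in the tree to cross `τ 1` under the
design force. The honest re-typing of the upper half at the first rung therefore has TWO stubs:

* `LocalContinuationAt k` — «every globally anchored registered stage at level `k` continues
  classically, with finite energy, under the design force, a little past `τ k`» (no ceiling asked):
  at `k = 1` a short-time forced existence statement across the end of the forced era — textbook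
  analysis (local well-posedness for smooth bounded finite-energy data and a smooth compactly
  supported force), OPEN IN THE TREE only; at `k ≥ 2` it is implied by the tree (silent stretch of
  positive length; ecbridge-5 g2);
* `AprioriCeilingAt k` — «every finite-energy classical continuation of such a stage on any
  `[0, T'] ⊆ [0, τ (k+1)]` stays inside the next ceiling `c₂ Y_{k+1}`» (no overshoot — the bet).

## What is proved (every `k ≥ 1`, unit viscosity, wide rates; no hypothesis)

* §1 `Stage.exists_glue_translated` — the gluing step: a local continuation `(u₁, p₁)` of a stage
  on `[0, τ k + δ]` and an UNFORCED classical `(w, r)` on `[0, T']`, `δ ≤ T'`, agreeing with the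
  translate `(u₁, p₁)(· + τ k)` on `[0, δ]`, glue (force silent after `τ 1 ≤ τ k`, `glue_Icc`) to a
  classical continuation of the stage on `[0, τ k + T']` whose translate is `w` on `[0, T']`.
* §2 `continuationEnvelopeAt_of_local_apriori (hk : 1 ≤ k) :
  LocalContinuationAt k → AprioriCeilingAt k → ContinuationEnvelopeAt k` — translate the local
  continuation to the origin `τ k` (unforced, positive length), bound every unforced continuation of
  it by gluing it back (§1) and invoking the a-priori ceiling, continue to `τ (k+1) - τ k` by
  `exists_classical_extension_Icc_of_apriori_bound`, glue back (§1); the converse projections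
  `ContinuationEnvelopeAt.localContinuationAt`, `ContinuationEnvelopeAt.aprioriCeilingAt` (the latter
  by ecbridge-6 g2's `velocity_eq_of_bounded_classical`: the envelope's continuation is the bounded
  competitor); hence `continuationEnvelopeAt_iff_local_and_apriori`.
* §3 the first rung: **`heredityAtOne_iff_local_apriori_floors :
  HeredityAtOne ↔ LocalContinuationAt 1 ∧ AprioriCeilingAt 1 ∧ ReadoutFloorsAt 1`** — item 19249 =
  «the level-1 flow crosses `τ₁`» ∧ «it never exceeds `(5/3)·Y₂` before `τ₂`» ∧ «at `τ₂` it shows the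
  level-2 floors»; premature loss of smoothness / of finite energy inside `(τ₁, τ₂]` is excluded by
  theorem once the first two hold.

References: J. C. Robinson, J. L. Rodrigo, W. Sadowski, *The Three-Dimensional Navier–Stokes
Equations*, CUP 2016, Lemma 8.16 / Thm. 8.17 and proof of Thm. 12.3
[cite: RobinsonRodrigoSadowski2016, Thm. 8.17]; J. T. Beale, T. Kato, A. Majda, Comm. Math. Phys. 94
(1984) §1 [cite: BealeKatoMajda1984, §1]; H. Sohr, *The Navier–Stokes Equations*, Birkhäuser 2001,
Ch. V Thm. 1.5.1 [cite: Sohr2001, Ch. V Thm. 1.5.1]; S. Palasek, arXiv:2605.13827 §4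
[cite: Palasek2026ElementaryModel, §4].
-/

noncomputable section

namespace Summit.NavierStokesRegularity.FluidComputer.PalasekTowerClayBridge

open Set MeasureTheory Filter Topology Function Real
open scoped ENNReal ContDiff NNReal
open Literature.Analysis.FluidPDE
open Summit.NavierStokesRegularity.NavierStokesRegularity

/-! ## §0 The two stubs of the upper half AT level `k` -/

/-- **LOCAL CONTINUATION AT level `k`** (open in the tree at `k ≤ 1`; never asserted): every globally
anchored registered stage at level `k` of a pinned (`Λ = 8`, `θ = 6/5`), rigid, quiet schedule on the
wide-base rates continues as a classical solution under the design force, with finite energy, to SOME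
time `T' > τ k`, agreeing with the stage in velocity and pressure on `[0, τ k]` — no ceiling, no floor.
At `k = 1`: the level-1 flow crosses the end `τ₁` of the forced era (short-time forced well-posedness
on `ℝ³` from the smooth bounded finite-energy slice `u(τ₁)`; at `k ≥ 2` a consequence of the tree's
unforced continuation theory). [cite: Palasek2026ElementaryModel, §4] -/
@[conjecture] def LocalContinuationAt (k : ℕ) : Prop :=
  ∀ S : Schedule TowerRates.wide, S.Pins 8 (6 / 5) → S.Rigid → S.Quiet →
    ∀ s : Stage 1 TowerRates.wide S (Margins.routeG TowerRates.wide) k,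
      ∃ T' : ℝ, S.τ k < T' ∧
        ∃ (u : ℝ → EuclideanSpace ℝ (Fin 3) → EuclideanSpace ℝ (Fin 3))
          (p : ℝ → EuclideanSpace ℝ (Fin 3) → ℝ),
          IsClassicalNSSolutionOn (Icc 0 T') 1 S.f u p ∧
          (∀ t ∈ Icc 0 (S.τ k), u t = s.u t ∧ p t = s.p t) ∧
          (∃ C : ℝ≥0∞, C < ⊤ ∧ ∀ t ∈ Icc 0 T', ∫⁻ x, ‖u t x‖ₑ ^ 2 ≤ C)

/-- **A-PRIORI CEILING AT level `k` — no overshoot** (open; never asserted; the level-`k` instance of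
the hypothesis of ecbridge-5 g2's `continuationEnvelope_of_apriori`): for every pinned rigid quiet wide
schedule, every globally anchored registered stage at level `k`, every `T' ∈ [τ k, τ (k+1)]` and every
finite-energy classical continuation of the stage on `[0, T']` (design force; velocity and pressure
agree on `[0, τ k]`), the speed stays `≤ c₂ Y_{k+1}` on `[0, T'] × ℝ³`. At `k = 1`: no continuation of
a level-1 flow exceeds `(5/3)·Y₂` before `τ₂`, for as long as it exists. [cite: Palasek2026ElementaryModel, §4] -/
@[conjecture] def AprioriCeilingAt (k : ℕ) : Prop :=
  ∀ S : Schedule TowerRates.wide, S.Pins 8 (6 / 5) → S.Rigid → S.Quiet →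
    ∀ s : Stage 1 TowerRates.wide S (Margins.routeG TowerRates.wide) k,
    ∀ T' ∈ Icc (S.τ k) (S.τ (k + 1)),
    ∀ (u : ℝ → EuclideanSpace ℝ (Fin 3) → EuclideanSpace ℝ (Fin 3))
      (p : ℝ → EuclideanSpace ℝ (Fin 3) → ℝ),
      IsClassicalNSSolutionOn (Icc 0 T') 1 S.f u p →
      (∀ t ∈ Icc 0 (S.τ k), u t = s.u t ∧ p t = s.p t) →
      (∃ C : ℝ≥0∞, C < ⊤ ∧ ∀ t ∈ Icc 0 T', ∫⁻ x, ‖u t x‖ₑ ^ 2 ≤ C) →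
      ∀ t ∈ Icc 0 T', ∀ x, ‖u t x‖ ≤ S.c₂ * TowerRates.wide.Y (k + 1)

/-! ## §1 Gluing an unforced continuation of the translated flow back onto the stage -/

namespace Stage

variable {ν : ℝ} {R : TowerRates} {S : Schedule R} {m : Margins R} {k : ℕ}

/-- **Glue-back.** Let `s` be a stage at level `k ≥ 1` of a QUIET schedule (force silent after
`τ 1 ≤ τ k`), `(u₁, p₁)` a classical continuation of `s` on `[0, τ k + δ]`, `δ > 0` (design force,
agreeing with `s` in velocity and pressure on `[0, τ k]`, finite energy), and `(w, r)` an UNFORCED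
classical solution on `[0, T']`, `δ ≤ T'`, with finite energy, agreeing with the translate
`(u₁, p₁)(· + τ k)` on `[0, δ]`. Then `s` has a classical continuation `(u, p)` on `[0, τ k + T']`
(design force), agreeing with `s` on `[0, τ k]`, of finite energy, with `u (σ + τ k) = w σ` for
`σ ∈ [0, T']` (translate `(w, r)` back by `τ k`, relabel its zero force as the silent design force,
`IsClassicalNSSolutionOn.glue_Icc` along the overlap `(τ k, τ k + δ)`, switching at `τ k + δ/2`).
[cite: BealeKatoMajda1984, §1] -/
theorem exists_glue_translated (hQ : S.Quiet) (hk : 1 ≤ k) (s : Stage ν R S m k) {δ T' : ℝ}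
    (hδ : 0 < δ) (hδT : δ ≤ T')
    {u₁ : ℝ → EuclideanSpace ℝ (Fin 3) → EuclideanSpace ℝ (Fin 3)}
    {p₁ : ℝ → EuclideanSpace ℝ (Fin 3) → ℝ}
    (h₁ : IsClassicalNSSolutionOn (Icc 0 (S.τ k + δ)) ν S.f u₁ p₁)
    (h₁s : ∀ t ∈ Icc 0 (S.τ k), u₁ t = s.u t ∧ p₁ t = s.p t)
    (hE₁ : ∃ C : ℝ≥0∞, C < ⊤ ∧ ∀ t ∈ Icc 0 (S.τ k + δ), ∫⁻ x, ‖u₁ t x‖ₑ ^ 2 ≤ C)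
    {w : ℝ → EuclideanSpace ℝ (Fin 3) → EuclideanSpace ℝ (Fin 3)}
    {r : ℝ → EuclideanSpace ℝ (Fin 3) → ℝ}
    (hw : IsClassicalNSSolutionOn (Icc 0 T') ν 0 w r)
    (hw₁ : ∀ σ ∈ Icc 0 δ, w σ = u₁ (σ + S.τ k) ∧ r σ = p₁ (σ + S.τ k))
    (hEw : ∃ C : ℝ≥0∞, C < ⊤ ∧ ∀ σ ∈ Icc 0 T', ∫⁻ x, ‖w σ x‖ₑ ^ 2 ≤ C) :
    ∃ (u : ℝ → EuclideanSpace ℝ (Fin 3) → EuclideanSpace ℝ (Fin 3))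
      (p : ℝ → EuclideanSpace ℝ (Fin 3) → ℝ),
      IsClassicalNSSolutionOn (Icc 0 (S.τ k + T')) ν S.f u p ∧
      (∀ t ∈ Icc 0 (S.τ k), u t = s.u t ∧ p t = s.p t) ∧
      (∃ C : ℝ≥0∞, C < ⊤ ∧ ∀ t ∈ Icc 0 (S.τ k + T'), ∫⁻ x, ‖u t x‖ₑ ^ 2 ≤ C) ∧
      ∀ σ ∈ Icc 0 T', u (σ + S.τ k) = w σ := by
  set τk : ℝ := S.τ k with hτk
  have hτk0 : 0 ≤ τk := (S.τ_pos k).le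
  have h1k : S.τ 1 ≤ τk := S.τ_mono hk
  -- the unforced continuation translated back to `[τ k, τ k + T']`, its force relabelled `S.f`
  set wb : ℝ → EuclideanSpace ℝ (Fin 3) → EuclideanSpace ℝ (Fin 3) := fun t => w (t + -τk) with hwb
  set rb : ℝ → EuclideanSpace ℝ (Fin 3) → ℝ := fun t => r (t + -τk) with hrb
  have hpre : Icc τk (τk + T') ⊆ (fun t => t + -τk) ⁻¹' Icc 0 T' := by
    intro t ht
    simp only [mem_preimage, mem_Icc] at ht ⊢
    constructor <;> linarith [ht.1, ht.2]
  have hwb0 : IsClassicalNSSolutionOn (Icc τk (τk + T')) ν (fun t => (0 : ℝ → EuclideanSpace ℝ (Fin 3) →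
      EuclideanSpace ℝ (Fin 3)) (t + -τk)) wb rb :=
    (hw.comp_add_right (-τk)).mono hpre (uniqueDiffOn_Icc (by linarith))
  have hwbf : IsClassicalNSSolutionOn (Icc τk (τk + T')) ν S.f wb rb :=
    hwb0.congr_force fun t ht x => by
      have hft : S.f t = 0 := hQ t (h1k.trans ht.1)
      simp only [Pi.zero_apply, hft]
  -- agreement on the overlap `(τ k, τ k + δ)`
  have hov : ∀ t ∈ Ioo τk (τk + δ), u₁ t = wb t ∧ p₁ t = rb t := by
    intro t ht
    have hσ : t + -τk ∈ Icc 0 δ := ⟨by linarith [ht.1], by linarith [ht.2]⟩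
    obtain ⟨hu, hp⟩ := hw₁ (t + -τk) hσ
    have e : t + -τk + τk = t := by ring
    rw [e] at hu hp
    exact ⟨hu.symm, hp.symm⟩
  -- glue, switching at `τ k + δ/2`
  have hglue := h₁.glue_Icc hwbf hτk0 (show τk < τk + δ / 2 by linarith)
    (show τk + δ / 2 < τk + δ by linarith) (show τk + δ ≤ τk + T' by linarith) hov
  refine ⟨_, _, hglue, ?_, ?_, ?_⟩
  · -- agreement with the stage on `[0, τ k]` (there `t ≤ τ k + δ/2`, the glued field is `(u₁, p₁)`)
    intro t ht
    have htm : t ≤ τk + δ / 2 := by linarith [ht.2]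
    simp only [if_pos htm]
    exact h₁s t ht
  · -- finite energy: the larger of the two bounds
    obtain ⟨C₁, hC₁, hb₁⟩ := hE₁
    obtain ⟨C₂, hC₂, hb₂⟩ := hEw
    refine ⟨max C₁ C₂, max_lt hC₁ hC₂, fun t ht => ?_⟩
    by_cases htm : t ≤ τk + δ / 2
    · simp only [if_pos htm]
      exact (hb₁ t ⟨ht.1, by linarith⟩).trans (le_max_left _ _)
    · simp only [if_neg htm]
      have hσ : t + -τk ∈ Icc 0 T' := ⟨by rw [not_le] at htm; linarith, by linarith [ht.2]⟩
      exact (hb₂ (t + -τk) hσ).trans (le_max_right _ _)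
  · -- the translate of the glued field is `w`
    intro σ hσ
    by_cases htm : σ + τk ≤ τk + δ / 2
    · simp only [if_pos htm]
      have hσδ : σ ∈ Icc 0 δ := ⟨hσ.1, by linarith⟩
      exact (hw₁ σ hσδ).1.symm
    · simp only [if_neg htm]
      show w (σ + τk + -τk) = w σ
      congr 1
      ring

end Stage

/-! ## §2 The upper half at level `k ≥ 1` ⇔ local continuation ∧ a-priori ceiling -/

/-- The upper half gives the local continuation (take `T' = τ (k+1)`). [folklore] -/
theorem ContinuationEnvelopeAt.localContinuationAt {k : ℕ} (h : ContinuationEnvelopeAt k) :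
    LocalContinuationAt k := by
  intro S hP hR hQ s
  obtain ⟨u, p, hcl, hagree, henergy, -⟩ := h S hP hR hQ s
  exact ⟨S.τ (k + 1), S.τ_lt_succ k, u, p, hcl, hagree, henergy⟩

/-- **The upper half gives the a-priori ceiling — no named fact**: a finite-energy classical
continuation on `[0, T']`, `T' ≤ τ (k+1)`, coincides there with the envelope's continuation, which is
the BOUNDED competitor (`velocity_eq_of_bounded_classical`, forced Serrin–Masuda, ecbridge-6 g2),
hence is inside the ceiling. [cite: Sohr2001, Ch. V Thm. 1.5.1] -/
theorem ContinuationEnvelopeAt.aprioriCeilingAt {k : ℕ} (h : ContinuationEnvelopeAt k) :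
    AprioriCeilingAt k := by
  intro S hP hR hQ s T' hT' u p hcl hagree henergy t ht x
  obtain ⟨u₁, p₁, hcl₁, hagree₁, henergy₁, hceil₁⟩ := h S hP hR hQ s
  have hT'0 : 0 < T' := (S.τ_pos k).trans_le hT'.1
  have hcl₁' : IsClassicalNSSolutionOn (Icc 0 T') 1 S.f u₁ p₁ :=
    hcl₁.mono (Icc_subset_Icc le_rfl hT'.2) (uniqueDiffOn_Icc hT'0)
  have henergy₁' : ∃ C : ℝ≥0∞, C < ⊤ ∧ ∀ t ∈ Icc 0 T', ∫⁻ x, ‖u₁ t x‖ₑ ^ 2 ≤ C := by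
    obtain ⟨C, hC, hb⟩ := henergy₁
    exact ⟨C, hC, fun t ht => hb t ⟨ht.1, ht.2.trans hT'.2⟩⟩
  have hB : ∀ t ∈ Icc 0 T', ∀ x, ‖u₁ t x‖ ≤ S.c₂ * TowerRates.wide.Y (k + 1) :=
    fun t ht x => hceil₁ t ⟨ht.1, ht.2.trans hT'.2⟩ x
  have h0 : (0 : ℝ) ∈ Icc 0 (S.τ k) := ⟨le_rfl, (S.τ_pos k).le⟩
  have h00 : u 0 = u₁ 0 := by rw [(hagree 0 h0).1, (hagree₁ 0 h0).1]
  have heq : ∀ t ∈ Icc 0 T', u t = u₁ t :=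
    velocity_eq_of_bounded_classical one_pos hT'0 S.force_smooth S.force_decay hcl₁' henergy₁' hB
      hcl henergy h00
  rw [heq t ht]
  exact hB t ht x

/-- **THE UPPER HALF FROM ITS TWO STUBS, every level `k ≥ 1` — no named fact.** Local continuation
past `τ k` and the a-priori ceiling up to `τ (k+1)` give the finite-energy classical continuation to
`τ (k+1)` inside the ceiling. Proof: restrict the local continuation to `[0, τ k + δ]`,
`δ = min (T' - τ k) (τ (k+1) - τ k) > 0`; its translate to the origin `τ k` is an UNFORCED classical
solution on `[0, δ]` (the force is silent after `τ 1 ≤ τ k`, `isClassicalNSSolutionOn_translate_of_silent`)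
with finite energy; every unforced finite-energy classical continuation of that translate on
`[0, T''] ⊆ [0, τ (k+1) - τ k]` glues back to a continuation of the stage
(`Stage.exists_glue_translated`), so the a-priori ceiling bounds it by `c₂ Y_{k+1}`; hence
`exists_classical_extension_Icc_of_apriori_bound` (RRS 2016 Thm. 8.17 / proof of Thm. 12.3) continues
the translate to `[0, τ (k+1) - τ k]`, and gluing back once more gives the continuation of the stage
to `τ (k+1)`, inside the ceiling by the a-priori hypothesis applied to it.
[cite: RobinsonRodrigoSadowski2016, Thm. 8.17] -/
theorem continuationEnvelopeAt_of_local_apriori {k : ℕ} (hk : 1 ≤ k) (hL : LocalContinuationAt k)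
    (hA : AprioriCeilingAt k) : ContinuationEnvelopeAt k := by
  intro S hP hR hQ s
  obtain ⟨T', hT', u₁, p₁, hcl₁, hagree₁, henergy₁⟩ := hL S hP hR hQ s
  set τk : ℝ := S.τ k with hτk
  set L₁ : ℝ := S.τ (k + 1) - τk with hL₁
  have hτk0 : 0 < τk := S.τ_pos k
  have hL₁0 : 0 < L₁ := by rw [hL₁]; linarith [S.τ_lt_succ k]
  have h1k : S.τ 1 ≤ τk := S.τ_mono hk
  -- the local continuation, cut to `[0, τ k + δ]` with `0 < δ ≤ L₁`
  set δ : ℝ := min (T' - τk) L₁ with hδ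
  have hδ0 : 0 < δ := lt_min (by linarith) hL₁0
  have hδL : δ ≤ L₁ := min_le_right _ _
  have hδT : τk + δ ≤ T' := by have := min_le_left (T' - τk) L₁; rw [← hδ] at this; linarith
  have hcl₁' : IsClassicalNSSolutionOn (Icc 0 (τk + δ)) 1 S.f u₁ p₁ :=
    hcl₁.mono (Icc_subset_Icc le_rfl hδT) (uniqueDiffOn_Icc (by linarith))
  have henergy₁' : ∃ C : ℝ≥0∞, C < ⊤ ∧ ∀ t ∈ Icc 0 (τk + δ), ∫⁻ x, ‖u₁ t x‖ₑ ^ 2 ≤ C := by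
    obtain ⟨C, hC, hb⟩ := henergy₁
    exact ⟨C, hC, fun t ht => hb t ⟨ht.1, ht.2.trans hδT⟩⟩
  -- its translate to the origin `τ k`: unforced, classical on `[0, δ]`, finite energy
  have htr : IsClassicalNSSolutionOn (Icc 0 (τk + δ - τk)) 1 0 (fun t => u₁ (t + τk))
      (fun t => p₁ (t + τk)) :=
    isClassicalNSSolutionOn_translate_of_silent hcl₁' hτk0.le (by linarith) (fun t ht => hQ t (h1k.trans ht))
  have eδ : τk + δ - τk = δ := by ring
  rw [eδ] at htr
  have hEtr : ∃ A : ℝ≥0∞, A < ⊤ ∧ ∀ t ∈ Icc 0 δ, ∫⁻ x, ‖u₁ (t + τk) x‖ₑ ^ 2 ≤ A := by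
    obtain ⟨C, hC, hb⟩ := henergy₁'
    exact ⟨C, hC, fun t ht => hb (t + τk) ⟨by linarith [ht.1], by linarith [ht.2]⟩⟩
  -- every unforced finite-energy continuation of the translate up to `L₁` is inside the ceiling
  have hM : ∀ T'' ∈ Icc δ L₁,
      ∀ (w : ℝ → EuclideanSpace ℝ (Fin 3) → EuclideanSpace ℝ (Fin 3))
        (r : ℝ → EuclideanSpace ℝ (Fin 3) → ℝ),
        IsClassicalNSSolutionOn (Icc 0 T'') 1 0 w r →
        (∀ t ∈ Icc 0 δ, w t = u₁ (t + τk) ∧ r t = p₁ (t + τk)) →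
        (∃ A : ℝ≥0∞, A < ⊤ ∧ ∀ t ∈ Icc 0 T'', ∫⁻ x, ‖w t x‖ₑ ^ 2 ≤ A) →
        ∀ t ∈ Icc 0 T'', ∀ x, ‖w t x‖ ≤ S.c₂ * TowerRates.wide.Y (k + 1) := by
    intro T'' hT'' w r hw hw₁ hEw t ht x
    obtain ⟨u, p, hcl, hagree, henergy, htrw⟩ :=
      s.exists_glue_translated hQ hk hδ0 hT''.1 hcl₁' hagree₁ henergy₁' hw hw₁ hEw
    have hslab : τk + T'' ∈ Icc (S.τ k) (S.τ (k + 1)) :=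
      ⟨by linarith [hT''.1], by rw [hL₁] at hT''; linarith [hT''.2]⟩
    have hb := hA S hP hR hQ s (τk + T'') hslab u p hcl hagree henergy (t + τk)
      ⟨by linarith [ht.1], by linarith [ht.2]⟩ x
    rwa [htrw t ht] at hb
  -- a-priori continuation of the translate to `[0, L₁]`
  obtain ⟨w, r, hw, hw₁, hEw, -⟩ :=
    exists_classical_extension_Icc_of_apriori_bound one_pos hδ0 hδL htr hEtr hM
  -- glue back: a continuation of the stage to `τ (k+1)`
  obtain ⟨u, p, hcl, hagree, henergy, -⟩ :=
    s.exists_glue_translated hQ hk hδ0 hδL hcl₁' hagree₁ henergy₁' hw hw₁ hEw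
  have eL : τk + L₁ = S.τ (k + 1) := by rw [hL₁]; ring
  rw [eL] at hcl henergy
  refine ⟨u, p, hcl, hagree, henergy, ?_⟩
  exact hA S hP hR hQ s (S.τ (k + 1)) ⟨S.τ_mono (Nat.le_succ k), le_rfl⟩ u p hcl hagree henergy

/-- **THE UPPER HALF AT level `k ≥ 1` RE-TYPED, no hypothesis**:
`ContinuationEnvelopeAt k ↔ LocalContinuationAt k ∧ AprioriCeilingAt k`. [cite: RobinsonRodrigoSadowski2016, Thm. 8.17] -/
theorem continuationEnvelopeAt_iff_local_and_apriori {k : ℕ} (hk : 1 ≤ k) :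
    ContinuationEnvelopeAt k ↔ LocalContinuationAt k ∧ AprioriCeilingAt k :=
  ⟨fun h => ⟨h.localContinuationAt, h.aprioriCeilingAt⟩,
    fun h => continuationEnvelopeAt_of_local_apriori hk h.1 h.2⟩

/-! ## §3 The first rung in three stubs -/

/-- **`ContinuationEnvelopeAt 1 ↔ LocalContinuationAt 1 ∧ AprioriCeilingAt 1`** — at the first rung
the upper half is «the level-1 flow crosses the end of the forced era» ∧ «no overshoot of `(5/3)·Y₂`
before `τ₂`». [cite: RobinsonRodrigoSadowski2016, Thm. 8.17] -/
theorem continuationEnvelopeAt_one_iff :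
    ContinuationEnvelopeAt 1 ↔ LocalContinuationAt 1 ∧ AprioriCeilingAt 1 :=
  continuationEnvelopeAt_iff_local_and_apriori le_rfl

/-- **THE FIRST RUNG IN THREE STUBS, no hypothesis**:
`HeredityAtOne ↔ LocalContinuationAt 1 ∧ AprioriCeilingAt 1 ∧ ReadoutFloorsAt 1` (item
stmt-NavierStokesRegularity-19249 = local forced continuation across `τ₁` ∧ no overshoot ∧ the
level-2 floors at `τ₂`; premature blow-up inside `(τ₁, τ₂]` is excluded by theorem given the first
two). [cite: RobinsonRodrigoSadowski2016, Thm. 8.17] -/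
theorem heredityAtOne_iff_local_apriori_floors :
    HeredityAtOne ↔ LocalContinuationAt 1 ∧ AprioriCeilingAt 1 ∧ ReadoutFloorsAt 1 := by
  rw [heredityAtOne_iff_envelopeAt_and_floorsAt, continuationEnvelopeAt_one_iff, and_assoc]

/-- The first rung from its three stubs (the composition a three-stub line on item 19249 would
register). [folklore] -/
theorem heredityAtOne_of_local_apriori_floors (hL : LocalContinuationAt 1) (hA : AprioriCeilingAt 1)
    (hF : ReadoutFloorsAt 1) : HeredityAtOne :=
  heredityAtOne_iff_local_apriori_floors.2 ⟨hL, hA, hF⟩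

/-- Heredity at any level `k ≥ 1` in three stubs, no hypothesis. [cite: RobinsonRodrigoSadowski2016, Thm. 8.17] -/
theorem heredityAt_iff_local_apriori_floors {k : ℕ} (hk : 1 ≤ k) :
    HeredityAt k ↔ LocalContinuationAt k ∧ AprioriCeilingAt k ∧ ReadoutFloorsAt k := by
  rw [heredityAt_iff_envelopeAt_and_floorsAt, continuationEnvelopeAt_iff_local_and_apriori hk,
    and_assoc]

end Summit.NavierStokesRegularity.FluidComputer.PalasekTowerClayBridge

end
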